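/-
Copyright (c) 2026 the pub-hodgecm-mathlib formalisation cell (harness21).  Prover seat hodgecm-mathlib-R90-CS-p03 (g0), R90-TF section S8 «ContSpec-n½» (dealer R90-CS-plan (g2),
deal S8-R65 (2)(b), census `R90/S8/CENSUS-PlaceLetters.R90-CS-p03-g0.md`): the PLACE LETTERS of ★ B2 `K2E1ChiIntertwiningScalarEulerJunctionU3` §3 discharged for the CM
extension `L∕L⁺` — inert∕split structure of the places above a good place, residue degrees, and the values at uniformisers of `η = φ′·ω_{L∕L⁺}` — and the two TOKENS with no letter left.
-/
import Summits.HodgeConjecture.HodgeConjecture.Theorems.K2E1ChiIntertwiningScalarEulerJunctionU3   -- ★ B2 (this seat): `prod_placesOver_eShape_mul_fShape_of_inert ∕ _of_split` (the two tokens under place letters)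
import Summits.HodgeConjecture.HodgeConjecture.Theorems.K2E1QuadraticHeckeCharCMPlaceValues          -- ★ (K2E2-p12): `valueAtUniformizer_quadraticHeckeCharCM_of_nonsplit ∕ _of_split` (`ω(ϖ_v) = ∓1`)
import Literature.NumberTheory.Automorphic.AsaiSignArchParityTwist                                   -- ★ `HeckeCharacter.valueAtUniformizer_restrict_of_smul_eq ∕ _of_smul_ne` (`φ′(ϖ_v)` at inert ∕ split places)
import Literature.NumberTheory.Automorphic.Liu2021.LemD1AsPrintedIndexedNonVacuityInertCofinite     -- ★ `inertiaDeg_eq_two_of_smul_eq_of_isUnramifiedIn` (`f(w∣v) = 2` at an inert unramified place)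
import Literature.NumberTheory.Automorphic.AdicCompletionDegreeOnePlaceEquiv                         -- ★ `absNorm_eq_absNorm_under_of_smul_ne` (`N_w = N_v` at a split place)
import Literature.NumberTheory.Automorphic.UnitaryGroupSplitPlace                                    -- ★ `PlacesOver.eq_or_eq_galInv`, `PlacesOver.galInv`
import HarnessLib

/-!
# K2·E1 ∕ R90·S8 — `K2E1CMPlaceLettersU3`: THE PLACE LETTERS OF THE `χ`-SCALAR JUNCTION FOR `L∕L⁺` — at a finite place `v` of `L⁺` unramified in the CM field `L`:
# (inert) `w ∣ v` unique, `N_w = q_v²`, `η(ϖ_v) = −φ(ϖ_w)`; (split) `{w, c⁻¹w} ∣ v`, `N = q_v`, `η(ϖ_v) = φ(ϖ_w)·φ(ϖ_{c⁻¹w})`, `η = φ′·ω_{L∕L⁺}` — AND ★ B2's TOKENS WITH NO LETTER LEFT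

Cell `pub/hodgecm-mathlib`, crux h413 = `stmt-HodgeConjecture-24833`, route of record `HCCMUnconditional`; R90-TF section S8 «ContSpec-n½» (file B ED. 4: #3 :409, #2♯ :433), road R2-χ₃
(`R90/S8/ROAD-S8B2.K2E1-p13-g3.md`, censuses `CENSUS-sock3-piN.R90-C10-p07-g0.md` §A∕§B1, `CENSUS-B2` ∕ `CENSUS-PlaceLetters.R90-CS-p03-g0.md`).  THEOREMS ONLY (no `def`, no `instance`,
no notation, no named-fact hypothesis, no `sorry`; default heartbeats); lane `--supports stmt-HodgeConjecture-24833 --as helper` (count-neutral).  Closes no socket.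

THE MATHEMATICS ([Rogawski1990, §13.9 p. 229]; [NeukirchANT1999, Ch. I §8–§9, Ch. VII §6]; [CasselsFrohlichANT1967, Ch. VII Prop. 1.2]).  ★ B2 §3 proves the per-place identities
«`(∏_{w ∣ v} E-shape_w(z))·F-shape_v(z)` = inert ∕ split token» under PLACE LETTERS: (inert) `hsub : ∀ w', w' = w`, `hN : N_w = q_v²`, `hηv : η(ϖ_v) = −φ(ϖ_w)`; (split) `hne`, `hall`,
`hN₁ hN₂ : N = q_v`, `hηv : η(ϖ_v) = e₁e₂`.  For the CM quadratic extension `L∕L⁺` with complex conjugation `c`, at a finite place `v` of `L⁺` UNRAMIFIED in `L` (`hunr`, ★ B1-local's binder)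
these are number-field facts already ★ in the Literature: the fibre of `w ↦ w ∩ 𝓞_{L⁺}` over `v` is the `{1, c}`-orbit of any `w ∣ v` (★ `PlacesOver.eq_of_smul_eq`, ★ `PlacesOver.eq_or_eq_galInv`),
`q_w = q_v^{f(w∣v)}` (★ `residueCard_eq_pow_inertiaDeg`) with `f = 2` at a `c`-fixed `w` (★ `inertiaDeg_eq_two_of_smul_eq_of_isUnramifiedIn`) and `f = 1` at a `c`-moved one (★
`absNorm_eq_absNorm_under_of_smul_ne`), and for the restriction `φ′ = ψ` of a Hecke character `φ` of `L` to `𝕀_{L⁺}` (HYPOTHESIS-FIRST: `hres : ∀ x, φ(ι x) = ψ x`, `ι =` ★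
`AdeleRing.ideleBaseChange`; no definition is posited) `ψ(ϖ_v) = φ(ϖ_w)` at an inert unramified `w` and `= φ(ϖ_w)·φ(ϖ_{cw})` at a split one (★ `HeckeCharacter.valueAtUniformizer_restrict_of_smul_eq
∕ _of_smul_ne`), while `ω = ε_{L∕L⁺} =` ★ `quadraticHeckeCharCM L` has `ω(ϖ_v) = −1 ∕ +1` (★ `valueAtUniformizer_quadraticHeckeCharCM_of_nonsplit ∕ _of_split`).  With `η := ψ·ω`:
* §1 the split fibre: `coe_galInv_complexConj` (`c⁻¹w = cw`), `galInv_ne_of_smul_ne` (`c⁻¹w ≠ w`), `smul_galInv_ne` (`c·(c⁻¹w) ≠ c⁻¹w`);  (`(χψ)(ϖ) = χ(ϖ)ψ(ϖ)` is ★ `HeckeCharacter.valueAtUniformizer_mul'`.)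
* §2 residue degrees: **`residueCard_eq_sq_of_smul_eq`** (`N_w = q_v²`, inert unramified), **`residueCard_eq_of_smul_ne`** (`N_w = q_v`, split);
* §3 the `η`-dictionary: `ramificationIdx_eq_one_of_isUnramifiedIn`, **`valueAtUniformizer_restrict_mul_quadratic_of_smul_eq`** (`η(ϖ_v) = −φ(ϖ_w)`),
  **`valueAtUniformizer_restrict_mul_quadratic_of_smul_ne`** (`η(ϖ_v) = φ(ϖ_w)·φ(ϖ_{c⁻¹w})`);
* §4 THE PACKAGED TOKENS — ★ B2 §3 with every place letter discharged: **`prod_placesOver_eShape_mul_fShape_eq_inertToken`**, **`prod_placesOver_eShape_mul_fShape_eq_splitToken`**.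
After this file the only non-local letter on the scalar road R2-χ₃ is the global restriction hypothesis `hres` (instantiated by the assembly ∕ F5 at `φ = φ_ξ`).
HONEST LABEL: HC_CM is proved only modulo the 7 printed citations (2 remaining named inputs: hLiu418 = `stmt-HodgeConjecture-24832`, h413 = `stmt-HodgeConjecture-24833`) until rung 0
closes; REL ≠ ★ ≠ BUILT; count-neutral helper; closes no socket.

## References
* [Rogawski1990] J. D. Rogawski, *Automorphic Representations of Unitary Groups in Three Variables*, Ann. of Math. Stud. 123 (1990): §13.9 p. 229.
* [NeukirchANT1999] J. Neukirch, *Algebraic Number Theory* (1999): Ch. I §8 Prop. (8.2), §9 (9.2); Ch. VII §6.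
* [CasselsFrohlichANT1967] J. W. S. Cassels, A. Fröhlich (eds.), *Algebraic Number Theory* (1967): Ch. VII (Tate) Prop. 1.2; Ch. II §11.
-/

set_option autoImplicit false
set_option linter.dupNamespace false  -- the mandated namespace repeats the summit's segment (`HodgeConjecture.HodgeConjecture`)

noncomputable section

open scoped NNReal
open Complex NumberField IsDedekindDomain
open Literature.NumberTheory.Automorphic Literature.NumberTheory.Automorphic.UnitaryGroup Literature.NumberTheory.LFunctions Literature.NumberTheory.GaloisRepresentations
open Literature.NumberTheory.Automorphic.Liu2021.LemD1IndexedNonVacuityInertCofinite (inertiaDeg_eq_two_of_smul_eq_of_isUnramifiedIn)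
open Summit.HodgeConjecture.HodgeConjecture.Cruxes.H413.K2E1QuadraticHeckeCharCMPlaceValues (valueAtUniformizer_quadraticHeckeCharCM_of_nonsplit valueAtUniformizer_quadraticHeckeCharCM_of_split)
open Summit.HodgeConjecture.HodgeConjecture.Cruxes.H413.K2E1ChiIntertwiningScalarEulerJunctionU3 (prod_placesOver_eShape_mul_fShape_of_inert prod_placesOver_eShape_mul_fShape_of_split)

namespace Summit.HodgeConjecture.HodgeConjecture.Cruxes.H413.K2E1CMPlaceLettersU3

variable (L : Type) [Field L] [NumberField L] [IsCMField L] {v : HeightOneSpectrum (𝓞 ↥(maximalRealSubfield L))}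

/-! ## §1 The fibre above a split place: `w` and `c⁻¹ • w` -/

/-- **The conjugate place is `c • w`**: `(galInv c w).1 = c⁻¹ • w.1 = c • w.1` (`c⁻¹ = c`, `c² = 1`; the equality `c⁻¹ = c` is ★ `CorCM…RecordSystemConj.complexConj_inv`, re-derived inline).
[cite: CasselsFrohlichANT1967, Ch. VII Prop. 1.2] -/
theorem coe_galInv_complexConj (w : PlacesOver L v) : (PlacesOver.galInv (IsCMField.complexConj L) w).1 = IsCMField.complexConj L • w.1 := by
  have hinv : (IsCMField.complexConj L)⁻¹ = IsCMField.complexConj L :=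
    inv_eq_of_mul_eq_one_right (AlgEquiv.ext fun x => IsCMField.complexConj_apply_apply L x)
  change (IsCMField.complexConj L)⁻¹ • w.1 = _
  rw [hinv]

/-- **At a split place the conjugate place is a second place**: `c • w ≠ w ⟹ galInv c w ≠ w`. [cite: CasselsFrohlichANT1967, Ch. VII Prop. 1.2] -/
theorem galInv_ne_of_smul_ne (w : PlacesOver L v) (hw : IsCMField.complexConj L • w.1 ≠ w.1) : PlacesOver.galInv (IsCMField.complexConj L) w ≠ w := by
  intro h
  apply hw
  rw [← coe_galInv_complexConj L w, h]

/-- `c` moves the conjugate place too: `c • (c⁻¹ • w) = w ≠ c⁻¹ • w`. [cite: CasselsFrohlichANT1967, Ch. VII Prop. 1.2] -/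
theorem smul_galInv_ne (w : PlacesOver L v) (hw : IsCMField.complexConj L • w.1 ≠ w.1) :
    IsCMField.complexConj L • (PlacesOver.galInv (IsCMField.complexConj L) w).1 ≠ (PlacesOver.galInv (IsCMField.complexConj L) w).1 := by
  intro h
  have h' : IsCMField.complexConj L • ((IsCMField.complexConj L)⁻¹ • w.1) = (PlacesOver.galInv (IsCMField.complexConj L) w).1 := h
  rw [smul_inv_smul, coe_galInv_complexConj L w] at h'
  exact hw h'.symm

/-! ## §2 Residue degrees: `N_w = q_v²` (inert, unramified) and `N_w = q_v` (split) -/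

/-- **`N_w = q_v²` AT AN INERT UNRAMIFIED PLACE**: `v` unramified in `L` (`hunr`), `w ∣ v` fixed by `c` ⟹ `f(w∣v) = 2` (★ `inertiaDeg_eq_two_of_smul_eq_of_isUnramifiedIn`: the fibre is `{w}`,
`#·e·f = 2`, `e = 1`) and `q_w = q_v^{f}` (★ `residueCard_eq_pow_inertiaDeg`). [cite: NeukirchANT1999, Ch. I §8 Prop. (8.2), §9 (9.2)] -/
theorem residueCard_eq_sq_of_smul_eq (hunr : Algebra.IsUnramifiedIn (𝓞 L) v.asIdeal) (w : PlacesOver L v) (hw : IsCMField.complexConj L • w.1 = w.1) :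
    w.1.residueCard = v.residueCard ^ 2 := by
  haveI : Algebra.IsQuadraticExtension ↥(maximalRealSubfield L) L := IsCMField.isQuadraticExtension L
  have hf := inertiaDeg_eq_two_of_smul_eq_of_isUnramifiedIn L (IsCMField.complexConj L) (IsCMField.complexConj_ne_one L) v hunr w hw
  have h := residueCard_eq_pow_inertiaDeg (F := ↥(maximalRealSubfield L)) w.1
  rw [hf, w.2] at h
  exact h

/-- **`N_w = q_v` AT A SPLIT PLACE** (`c • w ≠ w`: `f(w∣v) = 1`, ★ `absNorm_eq_absNorm_under_of_smul_ne`). [cite: CasselsFrohlichANT1967, Ch. VII Prop. 1.2] -/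
theorem residueCard_eq_of_smul_ne (w : PlacesOver L v) (hw : IsCMField.complexConj L • w.1 ≠ w.1) : w.1.residueCard = v.residueCard := by
  haveI : Algebra.IsQuadraticExtension ↥(maximalRealSubfield L) L := IsCMField.isQuadraticExtension L
  have h := absNorm_eq_absNorm_under_of_smul_ne ↥(maximalRealSubfield L) (IsCMField.complexConj L) hw
  rw [w.2] at h
  exact h

/-! ## §3 The `η`-dictionary: values at uniformisers of `η = φ′·ω_{L∕L⁺}` -/

omit [IsCMField L] in
/-- `e(w∣v) = 1` at a place unramified in `L` (Mathlib `Algebra.IsUnramifiedIn.ramificationIdx_eq_one`). [cite: NeukirchANT1999, Ch. I §8] -/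
theorem ramificationIdx_eq_one_of_isUnramifiedIn (hunr : Algebra.IsUnramifiedIn (𝓞 L) v.asIdeal) (w : PlacesOver L v) :
    w.1.asIdeal.ramificationIdx (𝓞 ↥(maximalRealSubfield L)) = 1 :=
  hunr.ramificationIdx_eq_one (PlacesOver.liesOver w)

/-- **INERT: `η(ϖ_v) = −φ(ϖ_w)`** for `η = ψ·ω_{L∕L⁺}`, `ψ = φ|_{𝕀_{L⁺}}` (`hres`), at a place `v` unramified in `L` with `c`-fixed `w ∣ v` at which `φ` is unramified: `ψ(ϖ_v) = φ(ϖ_w)` (★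
`valueAtUniformizer_restrict_of_smul_eq`: `ι_w ϖ_v` is a uniformiser of `L_w`, `e = 1`) and `ω(ϖ_v) = −1` (★ `valueAtUniformizer_quadraticHeckeCharCM_of_nonsplit`).  This is the letter `hηv`
of ★ B2's inert token with `e := φ(ϖ_w)`. [cite: NeukirchANT1999, Ch. VII §6] [cite: Rogawski1990, §13.9 p. 229] -/
theorem valueAtUniformizer_restrict_mul_quadratic_of_smul_eq (hunr : Algebra.IsUnramifiedIn (𝓞 L) v.asIdeal) (w : PlacesOver L v) (hw : IsCMField.complexConj L • w.1 = w.1)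
    {φ : HeckeCharacter L} {ψ : HeckeCharacter ↥(maximalRealSubfield L)} (hres : ∀ x, φ (AdeleRing.ideleBaseChange ↥(maximalRealSubfield L) L x) = ψ x)
    (hφw : φ.IsUnramifiedAt w.1) :
    (ψ * quadraticHeckeCharCM L).valueAtUniformizer v = -φ.valueAtUniformizer w.1 := by
  haveI : Algebra.IsQuadraticExtension ↥(maximalRealSubfield L) L := IsCMField.isQuadraticExtension L
  have hψ : ψ.valueAtUniformizer v = φ.valueAtUniformizer w.1 := by
    have h := HeckeCharacter.valueAtUniformizer_restrict_of_smul_eq (Algebra.IsQuadraticExtension.finrank_eq_two ↥(maximalRealSubfield L) L)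
      (IsCMField.complexConj_ne_one L) hres hw (ramificationIdx_eq_one_of_isUnramifiedIn L hunr w) hφw
    rwa [w.2] at h
  rw [HeckeCharacter.valueAtUniformizer_mul', hψ, valueAtUniformizer_quadraticHeckeCharCM_of_nonsplit L v w hw hunr, mul_neg_one]

/-- **SPLIT: `η(ϖ_v) = φ(ϖ_w)·φ(ϖ_{c⁻¹w})`** for `η = ψ·ω_{L∕L⁺}`, `ψ = φ|_{𝕀_{L⁺}}`, at a place `v` unramified in `L` with `c • w ≠ w`, `φ` unramified at `w` and at `c⁻¹ • w`: `ψ(ϖ_v) = φ(ϖ_w)·φ(ϖ_{cw})`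
(★ `valueAtUniformizer_restrict_of_smul_ne`, `c = c⁻¹`) and `ω(ϖ_v) = +1` (★ `valueAtUniformizer_quadraticHeckeCharCM_of_split`).  This is the letter `hηv` of ★ B2's split token with
`(e₁, e₂) := (φ(ϖ_w), φ(ϖ_{c⁻¹w}))`. [cite: NeukirchANT1999, Ch. VII §6] [cite: CasselsFrohlichANT1967, Ch. VII Prop. 1.2] -/
theorem valueAtUniformizer_restrict_mul_quadratic_of_smul_ne (hunr : Algebra.IsUnramifiedIn (𝓞 L) v.asIdeal) (w : PlacesOver L v) (hw : IsCMField.complexConj L • w.1 ≠ w.1)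
    {φ : HeckeCharacter L} {ψ : HeckeCharacter ↥(maximalRealSubfield L)} (hres : ∀ x, φ (AdeleRing.ideleBaseChange ↥(maximalRealSubfield L) L x) = ψ x)
    (hφw : φ.IsUnramifiedAt w.1) (hφw' : φ.IsUnramifiedAt (PlacesOver.galInv (IsCMField.complexConj L) w).1) :
    (ψ * quadraticHeckeCharCM L).valueAtUniformizer v = φ.valueAtUniformizer w.1 * φ.valueAtUniformizer (PlacesOver.galInv (IsCMField.complexConj L) w).1 := by
  haveI : Algebra.IsQuadraticExtension ↥(maximalRealSubfield L) L := IsCMField.isQuadraticExtension L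
  have hgal : (PlacesOver.galInv (IsCMField.complexConj L) w).1 = IsCMField.complexConj L • w.1 := coe_galInv_complexConj L w
  have hφcw : φ.IsUnramifiedAt (IsCMField.complexConj L • w.1) := hgal ▸ hφw'
  have hψ : ψ.valueAtUniformizer v = φ.valueAtUniformizer w.1 * φ.valueAtUniformizer (IsCMField.complexConj L • w.1) := by
    have h := HeckeCharacter.valueAtUniformizer_restrict_of_smul_ne (Algebra.IsQuadraticExtension.finrank_eq_two ↥(maximalRealSubfield L) L)
      (IsCMField.complexConj_ne_one L) hres hw (ramificationIdx_eq_one_of_isUnramifiedIn L hunr w) hφw hφcw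
    rwa [w.2] at h
  rw [HeckeCharacter.valueAtUniformizer_mul', hψ, valueAtUniformizer_quadraticHeckeCharCM_of_split L v w hw, mul_one, hgal]

/-! ## §4 The packaged tokens: ★ B2 §3 with every place letter discharged -/

/-- **THE INERT TOKEN, LETTER-FREE PER PLACE.**  `L` CM, `v` a finite place of `L⁺` unramified in `L`, `w ∣ v` fixed by `c` (inert), `φ` a Hecke character of `L` unramified at `w`,
`ψ = φ|_{𝕀_{L⁺}}` (`hres`), `η := ψ·ω_{L∕L⁺}`; `q := q_v`, `e := φ(ϖ_w)`.  Then ★ B2's bracket `(∏_{w' ∣ v} E-shape_{w'}(z))·F-shape_v(z)` equals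
`(1 − e·q^{−2z})(1 + e·q^{−(2z−1)}) ∕ ((1 − e·q^{−(2z−2)})(1 + e·q^{−(2z−2)}))` — ★ B1-local's token `chiLocalMean_eq_token_of_shell_nonsplit` VERBATIM, the `v`-factor of
`L(s,φ)L(2s,φ′ω)∕(L(s+1,φ)L(2s+1,φ′ω))` at `s = z − 1` (★ B2 `prod_placesOver_eShape_mul_fShape_of_inert` fed by §2–§3 and ★ `PlacesOver.eq_of_smul_eq`).
[cite: Rogawski1990, §13.9 p. 229] [cite: NeukirchANT1999, Ch. I §8 Prop. (8.2)] -/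
theorem prod_placesOver_eShape_mul_fShape_eq_inertToken (hunr : Algebra.IsUnramifiedIn (𝓞 L) v.asIdeal) (w : PlacesOver L v) (hw : IsCMField.complexConj L • w.1 = w.1)
    {φ : HeckeCharacter L} {ψ : HeckeCharacter ↥(maximalRealSubfield L)} (hres : ∀ x, φ (AdeleRing.ideleBaseChange ↥(maximalRealSubfield L) L x) = ψ x)
    (hφw : φ.IsUnramifiedAt w.1) (z : ℂ) :
    (∏ w' : PlacesOver L v, (1 - φ.valueAtUniformizer w'.1 * (w'.1.residueCard : ℂ) ^ (-z)) * (1 - φ.valueAtUniformizer w'.1 * (w'.1.residueCard : ℂ) ^ (-(z - 1)))⁻¹) *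
        ((1 - (ψ * quadraticHeckeCharCM L).valueAtUniformizer v * (v.residueCard : ℂ) ^ (-(2 * z - 1))) *
          (1 - (ψ * quadraticHeckeCharCM L).valueAtUniformizer v * (v.residueCard : ℂ) ^ (-(2 * z - 2)))⁻¹) =
      (1 - φ.valueAtUniformizer w.1 * (v.residueCard : ℂ) ^ (-(2 * z))) * (1 + φ.valueAtUniformizer w.1 * (v.residueCard : ℂ) ^ (-(2 * z - 1))) /
        ((1 - φ.valueAtUniformizer w.1 * (v.residueCard : ℂ) ^ (-(2 * z - 2))) * (1 + φ.valueAtUniformizer w.1 * (v.residueCard : ℂ) ^ (-(2 * z - 2)))) := by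
  haveI : Algebra.IsQuadraticExtension ↥(maximalRealSubfield L) L := IsCMField.isQuadraticExtension L
  exact prod_placesOver_eShape_mul_fShape_of_inert (φ := φ) (η := ψ * quadraticHeckeCharCM L) w
    (PlacesOver.eq_of_smul_eq (IsCMField.complexConj L) (IsCMField.complexConj_ne_one L) w hw)
    (residueCard_eq_sq_of_smul_eq L hunr w hw) rfl (valueAtUniformizer_restrict_mul_quadratic_of_smul_eq L hunr w hw hres hφw) z

/-- **THE SPLIT TOKEN, LETTER-FREE PER PLACE.**  `L` CM, `v` a finite place of `L⁺` unramified in `L`, `w ∣ v` with `c • w ≠ w` (split; the other place is `c⁻¹ • w`), `φ` a Hecke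
character of `L` unramified at `w` and at `c⁻¹ • w`, `ψ = φ|_{𝕀_{L⁺}}` (`hres`), `η := ψ·ω_{L∕L⁺}`; `q := q_v`, `e₁ := φ(ϖ_w)`, `e₂ := φ(ϖ_{c⁻¹w})`.  Then ★ B2's bracket equals the
two-exponent Gindikin–Karpelevich token `(1 − e₁q^{−z})(1 − e₂q^{−z})(1 − e₁e₂q^{−(2z−1)}) ∕ ((1 − e₁q^{−(z−1)})(1 − e₂q^{−(z−1)})(1 − e₁e₂q^{−(2z−2)}))` (★ B2
`prod_placesOver_eShape_mul_fShape_of_split` fed by §1–§3 and ★ `PlacesOver.eq_or_eq_galInv`). [cite: Rogawski1990, §13.9 p. 229] [cite: CasselsFrohlichANT1967, Ch. VII Prop. 1.2] -/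
theorem prod_placesOver_eShape_mul_fShape_eq_splitToken (hunr : Algebra.IsUnramifiedIn (𝓞 L) v.asIdeal) (w : PlacesOver L v) (hw : IsCMField.complexConj L • w.1 ≠ w.1)
    {φ : HeckeCharacter L} {ψ : HeckeCharacter ↥(maximalRealSubfield L)} (hres : ∀ x, φ (AdeleRing.ideleBaseChange ↥(maximalRealSubfield L) L x) = ψ x)
    (hφw : φ.IsUnramifiedAt w.1) (hφw' : φ.IsUnramifiedAt (PlacesOver.galInv (IsCMField.complexConj L) w).1) (z : ℂ) :
    (∏ w' : PlacesOver L v, (1 - φ.valueAtUniformizer w'.1 * (w'.1.residueCard : ℂ) ^ (-z)) * (1 - φ.valueAtUniformizer w'.1 * (w'.1.residueCard : ℂ) ^ (-(z - 1)))⁻¹) *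
        ((1 - (ψ * quadraticHeckeCharCM L).valueAtUniformizer v * (v.residueCard : ℂ) ^ (-(2 * z - 1))) *
          (1 - (ψ * quadraticHeckeCharCM L).valueAtUniformizer v * (v.residueCard : ℂ) ^ (-(2 * z - 2)))⁻¹) =
      (1 - φ.valueAtUniformizer w.1 * (v.residueCard : ℂ) ^ (-z)) * (1 - φ.valueAtUniformizer (PlacesOver.galInv (IsCMField.complexConj L) w).1 * (v.residueCard : ℂ) ^ (-z)) *
          (1 - φ.valueAtUniformizer w.1 * φ.valueAtUniformizer (PlacesOver.galInv (IsCMField.complexConj L) w).1 * (v.residueCard : ℂ) ^ (-(2 * z - 1))) /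
        ((1 - φ.valueAtUniformizer w.1 * (v.residueCard : ℂ) ^ (-(z - 1))) * (1 - φ.valueAtUniformizer (PlacesOver.galInv (IsCMField.complexConj L) w).1 * (v.residueCard : ℂ) ^ (-(z - 1))) *
          (1 - φ.valueAtUniformizer w.1 * φ.valueAtUniformizer (PlacesOver.galInv (IsCMField.complexConj L) w).1 * (v.residueCard : ℂ) ^ (-(2 * z - 2)))) := by
  haveI : Algebra.IsQuadraticExtension ↥(maximalRealSubfield L) L := IsCMField.isQuadraticExtension L
  exact prod_placesOver_eShape_mul_fShape_of_split (φ := φ) (η := ψ * quadraticHeckeCharCM L) w (PlacesOver.galInv (IsCMField.complexConj L) w)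
    (galInv_ne_of_smul_ne L w hw).symm (fun w' => PlacesOver.eq_or_eq_galInv (IsCMField.complexConj L) (IsCMField.complexConj_ne_one L) w w')
    (residueCard_eq_of_smul_ne L w hw) (residueCard_eq_of_smul_ne L (PlacesOver.galInv (IsCMField.complexConj L) w) (smul_galInv_ne L w hw)) rfl rfl
    (valueAtUniformizer_restrict_mul_quadratic_of_smul_ne L hunr w hw hres hφw hφw') z

end Summit.HodgeConjecture.HodgeConjecture.Cruxes.H413.K2E1CMPlaceLettersU3

end
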